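import Mathlib
import Summits.Ventures.Crystal3D.Theorems.StickyWulffConstantLayerChainDefs
import Summits.Ventures.Crystal3D.Theorems.StickyWulffConstantStackingLiminfStackSlicing
import HarnessLib

/-!
# Volumes of the stacking Wulff bodies: `|W_0| = 64√2` and `|W_f| ≥ 4√2 (16 + f(1−f))`
# (the lower half of the banked `StackVolumeLaw` of line `LayerChain`, crux `StackingLiminf`,
# stmt-Ventures-19145; fcc/twin are the unique volume minimisers among homogeneous statistics)

Route `StickyWulffConstant` of the venture `Summits/Ventures/Crystal3D` (cell `crystal3d-full`).
Over the landed vocabulary `StickyWulffConstantLayerChainDefs` (p473239).  By Cavalieri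
(`volume_stackWulff_eq_lintegral`) and the chamber-wise section areas (`…StackSlicing`):
* `volume (stackWulff 0) = 64 √2` — the truncated octahedron at bond length `1` (`√2 ×` the cubic
  body of volume `32`), EXACT (inner and outer windows coincide at `f = 0`);
* `4 √2 (16 + f (1 − f)) ≤ volume (stackWulff f)` for `f ∈ [0,1]` (inner windows only), hence
  `volume (stackWulff 0) < volume (stackWulff f)` for `0 < f < 1`: among height-homogeneous letter
  statistics fcc (`f = 0`) and its twin (`f = 1`) are the unique minimisers of the homogenised
  Wulff-body volume, with a first-order penalty `≥ 4√2 f(1−f)` in the minority-letter density —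
  the kernel form of the cell's certified law `27|W_λ| = 432 + 27λ(1−λ)` (cf-p2 R13 / R19, kit
  j244957, j257743, j257744) on the lower side.
WHAT THIS IS NOT: the upper half `volume (stackWulff f) ≤ 4√2(16 + f(1−f))` for `0 < f < 1`
(needs the `f`-dependent facets of `W_f`); nothing about clusters; rung F-C1 not moved.
-/

noncomputable section

namespace Summit.Ventures.Crystal3D.Theorems

open MeasureTheory Set
open Summit.Ventures.Crystal3D.LayerChain

/-- `∫_a^b (α + β y + γ y²) dy`. -/
theorem integral_quadratic (a b α β γ : ℝ) :
    ∫ y in a..b, (α + β * y + γ * y ^ 2) =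
      α * (b - a) + β * ((b ^ 2 - a ^ 2) / 2) + γ * ((b ^ 3 - a ^ 3) / 3) := by
  have i1 : IntervalIntegrable (fun _ : ℝ => α) volume a b := intervalIntegrable_const
  have i2 : IntervalIntegrable (fun y : ℝ => β * y) volume a b :=
    Continuous.intervalIntegrable (by fun_prop) _ _
  have i3 : IntervalIntegrable (fun y : ℝ => γ * y ^ 2) volume a b :=
    Continuous.intervalIntegrable (by fun_prop) _ _
  rw [intervalIntegral.integral_add (i1.add i2) i3, intervalIntegral.integral_add i1 i2,
    intervalIntegral.integral_const, intervalIntegral.integral_const_mul,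
    intervalIntegral.integral_const_mul, integral_id, integral_pow, smul_eq_mul]
  norm_num
  ring

/-- A set integral of a nonnegative continuous function over a finite interval, as an `ofReal`. -/
theorem lintegral_Icc_ofReal_eq (g : ℝ → ℝ) (hg : Continuous g) {a b : ℝ} (hab : a ≤ b)
    (hnn : ∀ y ∈ Icc a b, 0 ≤ g y) :
    ∫⁻ y in Icc a b, ENNReal.ofReal (g y) = ENNReal.ofReal (∫ y in a..b, g y) := by
  rw [← ofReal_integral_eq_lintegral_ofReal (hg.continuousOn.integrableOn_Icc)
    ((ae_restrict_iff' measurableSet_Icc).2 (Filter.Eventually.of_forall hnn)),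
    integral_Icc_eq_integral_Ioc, ← intervalIntegral.integral_of_le hab]

/-- Same over a half-open interval `Ioc a b`. -/
theorem lintegral_Ioc_ofReal_eq (g : ℝ → ℝ) (hg : Continuous g) {a b : ℝ} (hab : a ≤ b)
    (hnn : ∀ y ∈ Icc a b, 0 ≤ g y) :
    ∫⁻ y in Ioc a b, ENNReal.ofReal (g y) = ENNReal.ofReal (∫ y in a..b, g y) := by
  rw [← lintegral_Icc_ofReal_eq g hg hab hnn, ← restrict_Ioc_eq_restrict_Icc]

/-! ### The three chamber integrals (`h = √(2/3)`; each equals `√3·h·(scaled value)`) -/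

/-- Middle chamber: `∫_{−h}^{h} √3 (27/2 − ((1−2f) y/h)²/2) dy = √3 h (27 − (1−2f)²/3)`. -/
theorem integral_mid (f : ℝ) {h : ℝ} (hh : h ≠ 0) :
    ∫ y in (-h)..h, Real.sqrt 3 * (27 / 2 - ((1 - 2 * f) * (y / h)) ^ 2 / 2) =
      Real.sqrt 3 * h * (27 - (1 - 2 * f) ^ 2 / 3) := by
  have e : (fun y : ℝ => Real.sqrt 3 * (27 / 2 - ((1 - 2 * f) * (y / h)) ^ 2 / 2)) =
      fun y => Real.sqrt 3 * 27 / 2 + 0 * y + (-(Real.sqrt 3 * (1 - 2 * f) ^ 2 / (2 * h ^ 2))) * y ^ 2 := by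
    funext y; field_simp; ring
  rw [e, integral_quadratic]
  field_simp
  ring

/-- Top chamber: `∫_{h}^{3h} √3 A_f(y/h) dy = √3 h (56/3 + (4/3) f(1−f))`, with
`A_f(Z) = 6 + 3s + s²/4 + f s (s − f s)/2`, `s = 3 − Z`. -/
theorem integral_top (f : ℝ) {h : ℝ} (hh : h ≠ 0) :
    ∫ y in h..(3 * h), Real.sqrt 3 * (6 + 3 * (3 - y / h) + (3 - y / h) ^ 2 / 4 +
        f * (3 - y / h) * ((3 - y / h) - f * (3 - y / h)) / 2) =
      Real.sqrt 3 * h * (56 / 3 + 4 / 3 * (f * (1 - f))) := by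
  have e : (fun y : ℝ => Real.sqrt 3 * (6 + 3 * (3 - y / h) + (3 - y / h) ^ 2 / 4 +
        f * (3 - y / h) * ((3 - y / h) - f * (3 - y / h)) / 2)) =
      fun y => Real.sqrt 3 * (15 + 9 * (1 / 4 + f * (1 - f) / 2)) +
        (-(Real.sqrt 3 * (3 + 6 * (1 / 4 + f * (1 - f) / 2)) / h)) * y +
        (Real.sqrt 3 * (1 / 4 + f * (1 - f) / 2) / h ^ 2) * y ^ 2 := by
    funext y; field_simp; ring
  rw [e, integral_quadratic]
  field_simp
  ring

/-- Bottom chamber: `∫_{−3h}^{−h} √3 A_f(−y/h… ) dy = √3 h (56/3 + (4/3) f(1−f))` (`s = 3 + Z`). -/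
theorem integral_bot (f : ℝ) {h : ℝ} (hh : h ≠ 0) :
    ∫ y in (-(3 * h))..(-h), Real.sqrt 3 * (6 + 3 * (3 + y / h) + (3 + y / h) ^ 2 / 4 +
        f * (3 + y / h) * ((3 + y / h) - f * (3 + y / h)) / 2) =
      Real.sqrt 3 * h * (56 / 3 + 4 / 3 * (f * (1 - f))) := by
  have e : (fun y : ℝ => Real.sqrt 3 * (6 + 3 * (3 + y / h) + (3 + y / h) ^ 2 / 4 +
        f * (3 + y / h) * ((3 + y / h) - f * (3 + y / h)) / 2)) =
      fun y => Real.sqrt 3 * (15 + 9 * (1 / 4 + f * (1 - f) / 2)) +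
        (Real.sqrt 3 * (3 + 6 * (1 / 4 + f * (1 - f) / 2)) / h) * y +
        (Real.sqrt 3 * (1 / 4 + f * (1 - f) / 2) / h ^ 2) * y ^ 2 := by
    funext y; field_simp; ring
  rw [e, integral_quadratic]
  field_simp
  ring

/-! ### Chamber-wise lower bounds on `∫⁻ area(stackSlice f y)` -/

/-- The three chambers, as height intervals, and the set-integral lower bounds on them. -/
theorem setLIntegral_chambers_ge (f : ℝ) (hf0 : 0 ≤ f) (hf1 : f ≤ 1) :
    ENNReal.ofReal (Real.sqrt 3 * Real.sqrt (2 / 3) * (27 - (1 - 2 * f) ^ 2 / 3)) ≤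
        ∫⁻ y in Ioc (-Real.sqrt (2 / 3)) (Real.sqrt (2 / 3)), volume (stackSlice f y) ∧
      ENNReal.ofReal (Real.sqrt 3 * Real.sqrt (2 / 3) * (56 / 3 + 4 / 3 * (f * (1 - f)))) ≤
        ∫⁻ y in Ioc (Real.sqrt (2 / 3)) (3 * Real.sqrt (2 / 3)), volume (stackSlice f y) ∧
      ENNReal.ofReal (Real.sqrt 3 * Real.sqrt (2 / 3) * (56 / 3 + 4 / 3 * (f * (1 - f)))) ≤
        ∫⁻ y in Icc (-(3 * Real.sqrt (2 / 3))) (-Real.sqrt (2 / 3)), volume (stackSlice f y) := by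
  set h := Real.sqrt (2 / 3) with hh
  have hpos : 0 < h := Real.sqrt_pos.2 (by norm_num)
  have hne : h ≠ 0 := hpos.ne'
  have hy : ∀ y : ℝ, h * (y / h) = y := fun y => mul_div_cancel₀ y hne
  have hf : 0 ≤ f * (1 - f) := mul_nonneg hf0 (by linarith)
  refine ⟨?_, ?_, ?_⟩
  · -- middle chamber
    rw [← integral_mid f hne, ← lintegral_Ioc_ofReal_eq _ (by fun_prop) (by linarith)]
    · refine setLIntegral_mono' measurableSet_Ioc fun y hy' => ?_
      have hZ1 : -1 ≤ y / h := by rw [le_div_iff₀ hpos]; linarith [hy'.1]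
      have hZ2 : y / h ≤ 1 := by rw [div_le_iff₀ hpos]; linarith [hy'.2]
      have := le_volume_stackSlice_mid f (y / h) hf0 hf1 hZ1 hZ2
      rwa [hy] at this
    · intro y hy'
      have hZ1 : -1 ≤ y / h := by rw [le_div_iff₀ hpos]; linarith [hy'.1]
      have hZ2 : y / h ≤ 1 := by rw [div_le_iff₀ hpos]; linarith [hy'.2]
      have hw : ((1 - 2 * f) * (y / h)) ^ 2 ≤ 1 := by
        have h1 : -1 ≤ (1 - 2 * f) * (y / h) := by nlinarith
        have h2 : (1 - 2 * f) * (y / h) ≤ 1 := by nlinarith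
        nlinarith
      have : 0 ≤ 27 / 2 - ((1 - 2 * f) * (y / h)) ^ 2 / 2 := by linarith
      positivity
  · -- top chamber
    rw [← integral_top f hne, ← lintegral_Ioc_ofReal_eq _ (by fun_prop) (by linarith)]
    · refine setLIntegral_mono' measurableSet_Ioc fun y hy' => ?_
      have hZ1 : 1 ≤ y / h := by rw [le_div_iff₀ hpos]; linarith [hy'.1]
      have hZ2 : y / h ≤ 3 := by rw [div_le_iff₀ hpos]; linarith [hy'.2]
      have := le_volume_stackSlice_top f (y / h) hf0 hf1 hZ1 hZ2
      rwa [hy] at this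
    · intro y hy'
      have hZ1 : 1 ≤ y / h := by rw [le_div_iff₀ hpos]; linarith [hy'.1]
      have hZ2 : y / h ≤ 3 := by rw [div_le_iff₀ hpos]; linarith [hy'.2]
      have ht0 : 0 ≤ 3 - y / h := by linarith
      have : 0 ≤ f * (3 - y / h) * ((3 - y / h) - f * (3 - y / h)) := by
        have : (3 - y / h) - f * (3 - y / h) = (1 - f) * (3 - y / h) := by ring
        rw [this]; have := mul_nonneg hf (mul_nonneg ht0 ht0); nlinarith
      positivity
  · -- bottom chamber
    rw [← integral_bot f hne, ← lintegral_Icc_ofReal_eq _ (by fun_prop) (by linarith)]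
    · refine setLIntegral_mono' measurableSet_Icc fun y hy' => ?_
      have hZ1 : -3 ≤ y / h := by rw [le_div_iff₀ hpos]; linarith [hy'.1]
      have hZ2 : y / h ≤ -1 := by rw [div_le_iff₀ hpos]; linarith [hy'.2]
      have := le_volume_stackSlice_bot f (y / h) hf0 hf1 hZ1 hZ2
      rwa [hy] at this
    · intro y hy'
      have hZ1 : -3 ≤ y / h := by rw [le_div_iff₀ hpos]; linarith [hy'.1]
      have hZ2 : y / h ≤ -1 := by rw [div_le_iff₀ hpos]; linarith [hy'.2]
      have ht0 : 0 ≤ 3 + y / h := by linarith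
      have : 0 ≤ f * (3 + y / h) * ((3 + y / h) - f * (3 + y / h)) := by
        have : (3 + y / h) - f * (3 + y / h) = (1 - f) * (3 + y / h) := by ring
        rw [this]; have := mul_nonneg hf (mul_nonneg ht0 ht0); nlinarith
      positivity

/-- `√3 · √(2/3) = √2`. -/
theorem sqrt_three_mul_sqrt_two_thirds : Real.sqrt 3 * Real.sqrt (2 / 3) = Real.sqrt 2 := by
  rw [← Real.sqrt_mul (by norm_num)]; norm_num

/-- **Lower half of the volume law.** `4√2 (16 + f(1−f)) ≤ |W_f|` for `f ∈ [0,1]`. -/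
theorem le_volume_stackWulff (f : ℝ) (hf0 : 0 ≤ f) (hf1 : f ≤ 1) :
    ENNReal.ofReal (4 * Real.sqrt 2 * (16 + f * (1 - f))) ≤ volume (stackWulff f) := by
  set h := Real.sqrt (2 / 3) with hh
  have hpos : 0 < h := Real.sqrt_pos.2 (by norm_num)
  obtain ⟨hmid, htop, hbot⟩ := setLIntegral_chambers_ge f hf0 hf1
  have hf : 0 ≤ f * (1 - f) := mul_nonneg hf0 (by linarith)
  have hs : 0 < Real.sqrt 3 := Real.sqrt_pos.2 (by norm_num)
  -- the three chambers are pairwise disjoint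
  have hd1 : Disjoint (Icc (-(3 * h)) (-h)) (Ioc (-h) h) := by
    rw [Set.disjoint_left]; intro y hy hy'; exact absurd hy'.1 (not_lt.2 hy.2)
  have hd2 : Disjoint (Icc (-(3 * h)) (-h) ∪ Ioc (-h) h) (Ioc h (3 * h)) := by
    rw [Set.disjoint_left]; rintro y (hy | hy) hy'
    · linarith [hy.2, hy'.1]
    · exact absurd hy'.1 (not_lt.2 hy.2)
  have hA : 0 ≤ Real.sqrt 3 * h * (27 - (1 - 2 * f) ^ 2 / 3) :=
    mul_nonneg (mul_nonneg hs.le hpos.le) (by nlinarith)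
  have hB : 0 ≤ Real.sqrt 3 * h * (56 / 3 + 4 / 3 * (f * (1 - f))) := by positivity
  rw [volume_stackWulff_eq_lintegral]
  calc ENNReal.ofReal (4 * Real.sqrt 2 * (16 + f * (1 - f)))
      = ENNReal.ofReal (Real.sqrt 3 * h * (56 / 3 + 4 / 3 * (f * (1 - f)))) +
          ENNReal.ofReal (Real.sqrt 3 * h * (27 - (1 - 2 * f) ^ 2 / 3)) +
          ENNReal.ofReal (Real.sqrt 3 * h * (56 / 3 + 4 / 3 * (f * (1 - f)))) := by
        rw [← ENNReal.ofReal_add hB hA, ← ENNReal.ofReal_add (add_nonneg hB hA) hB]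
        congr 1
        rw [hh, ← sqrt_three_mul_sqrt_two_thirds]; ring
    _ ≤ (∫⁻ y in Icc (-(3 * h)) (-h), volume (stackSlice f y)) +
          (∫⁻ y in Ioc (-h) h, volume (stackSlice f y)) +
          ∫⁻ y in Ioc h (3 * h), volume (stackSlice f y) := by
        gcongr
    _ = ∫⁻ y in (Icc (-(3 * h)) (-h) ∪ Ioc (-h) h) ∪ Ioc h (3 * h), volume (stackSlice f y) := by
        rw [lintegral_union measurableSet_Ioc hd2, lintegral_union measurableSet_Ioc hd1]
    _ ≤ ∫⁻ y, volume (stackSlice f y) := setLIntegral_le_lintegral _ _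

/-- **`|W_0| = 64 √2`**: the truncated octahedron of the fcc stacking at bond length `1`. -/
theorem volume_stackWulff_zero : volume (stackWulff 0) = ENNReal.ofReal (64 * Real.sqrt 2) := by
  set h := Real.sqrt (2 / 3) with hh
  have hpos : 0 < h := Real.sqrt_pos.2 (by norm_num)
  have hne : h ≠ 0 := hpos.ne'
  have hy : ∀ y : ℝ, h * (y / h) = y := fun y => mul_div_cancel₀ y hne
  have hs : 0 < Real.sqrt 3 := Real.sqrt_pos.2 (by norm_num)
  rw [volume_stackWulff_eq_lintegral]
  -- outside `[-3h, 3h]` the sections are empty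
  have hout : ∀ y, y ∉ Icc (-(3 * h)) (3 * h) → volume (stackSlice 0 y) = 0 := by
    intro y hy'
    have hZ : 3 < |y / h| := by
      rw [mem_Icc, not_and_or, not_le, not_le] at hy'
      rcases hy' with hy' | hy'
      · have : y / h < -3 := by rw [div_lt_iff₀ hpos]; linarith
        have hneg : y / h < 0 := by linarith
        rw [abs_of_neg hneg]; linarith
      · have : 3 < y / h := by rw [lt_div_iff₀ hpos]; linarith
        rw [abs_of_pos (by linarith)]; exact this
    have := stackSlice_zero_eq_empty hZ
    rw [hy] at this
    rw [this, measure_empty]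
  have hind : (fun y => volume (stackSlice 0 y)) =
      (Icc (-(3 * h)) (3 * h)).indicator fun y => volume (stackSlice 0 y) := by
    funext y
    by_cases hy' : y ∈ Icc (-(3 * h)) (3 * h)
    · rw [indicator_of_mem hy']
    · rw [indicator_of_notMem hy', hout y hy']
  rw [hind, lintegral_indicator measurableSet_Icc]
  -- split into the three chambers
  have hsplit : Icc (-(3 * h)) (3 * h) = (Icc (-(3 * h)) (-h) ∪ Ioc (-h) h) ∪ Ioc h (3 * h) := by
    rw [Icc_union_Ioc_eq_Icc (by linarith) (by linarith), Icc_union_Ioc_eq_Icc (by linarith)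
      (by linarith)]
  have hd1 : Disjoint (Icc (-(3 * h)) (-h)) (Ioc (-h) h) := by
    rw [Set.disjoint_left]; intro y hy₁ hy₂; exact absurd hy₂.1 (not_lt.2 hy₁.2)
  have hd2 : Disjoint (Icc (-(3 * h)) (-h) ∪ Ioc (-h) h) (Ioc h (3 * h)) := by
    rw [Set.disjoint_left]; rintro y (hy₁ | hy₁) hy₂
    · linarith [hy₁.2, hy₂.1]
    · exact absurd hy₂.1 (not_lt.2 hy₁.2)
  rw [hsplit, lintegral_union measurableSet_Ioc hd2, lintegral_union measurableSet_Ioc hd1]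
  -- evaluate each chamber exactly
  have ebot : ∫⁻ y in Icc (-(3 * h)) (-h), volume (stackSlice 0 y) =
      ENNReal.ofReal (Real.sqrt 3 * h * (56 / 3 + 4 / 3 * (0 * (1 - 0)))) := by
    rw [← integral_bot 0 hne, ← lintegral_Icc_ofReal_eq _ (by fun_prop) (by linarith)]
    · refine setLIntegral_congr_fun measurableSet_Icc fun y hy' => ?_
      have hZ1 : -3 ≤ y / h := by rw [le_div_iff₀ hpos]; linarith [hy'.1]
      have hZ2 : y / h ≤ -1 := by rw [div_le_iff₀ hpos]; linarith [hy'.2]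
      have := volume_stackSlice_zero_bot (y / h) hZ1 hZ2
      rw [hy] at this
      rw [this]; congr 1; ring
    · intro y hy'
      have hZ1 : -3 ≤ y / h := by rw [le_div_iff₀ hpos]; linarith [hy'.1]
      have ht0 : 0 ≤ 3 + y / h := by linarith
      have : 0 ≤ 0 * (3 + y / h) * ((3 + y / h) - 0 * (3 + y / h)) := by simp
      positivity
  have emid : ∫⁻ y in Ioc (-h) h, volume (stackSlice 0 y) =
      ENNReal.ofReal (Real.sqrt 3 * h * (27 - (1 - 2 * 0) ^ 2 / 3)) := by
    rw [← integral_mid 0 hne, ← lintegral_Ioc_ofReal_eq _ (by fun_prop) (by linarith)]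
    · refine setLIntegral_congr_fun measurableSet_Ioc fun y hy' => ?_
      have hZ1 : -1 ≤ y / h := by rw [le_div_iff₀ hpos]; linarith [hy'.1]
      have hZ2 : y / h ≤ 1 := by rw [div_le_iff₀ hpos]; linarith [hy'.2]
      have := volume_stackSlice_zero_mid (y / h) hZ1 hZ2
      rw [hy] at this
      rw [this]; congr 1; ring
    · intro y hy'
      have hZ1 : -1 ≤ y / h := by rw [le_div_iff₀ hpos]; linarith [hy'.1]
      have hZ2 : y / h ≤ 1 := by rw [div_le_iff₀ hpos]; linarith [hy'.2]
      have hw : ((1 - 2 * 0) * (y / h)) ^ 2 ≤ 1 := by nlinarith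
      have : 0 ≤ 27 / 2 - ((1 - 2 * 0) * (y / h)) ^ 2 / 2 := by linarith
      positivity
  have etop : ∫⁻ y in Ioc h (3 * h), volume (stackSlice 0 y) =
      ENNReal.ofReal (Real.sqrt 3 * h * (56 / 3 + 4 / 3 * (0 * (1 - 0)))) := by
    rw [← integral_top 0 hne, ← lintegral_Ioc_ofReal_eq _ (by fun_prop) (by linarith)]
    · refine setLIntegral_congr_fun measurableSet_Ioc fun y hy' => ?_
      have hZ1 : 1 ≤ y / h := by rw [le_div_iff₀ hpos]; linarith [hy'.1]
      have hZ2 : y / h ≤ 3 := by rw [div_le_iff₀ hpos]; linarith [hy'.2]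
      have := volume_stackSlice_zero_top (y / h) hZ1 hZ2
      rw [hy] at this
      rw [this]; congr 1; ring
    · intro y hy'
      have hZ2 : y / h ≤ 3 := by rw [div_le_iff₀ hpos]; linarith [hy'.2]
      have ht0 : 0 ≤ 3 - y / h := by linarith
      have : 0 ≤ 0 * (3 - y / h) * ((3 - y / h) - 0 * (3 - y / h)) := by simp
      positivity
  have hA : 0 ≤ Real.sqrt 3 * h * (27 - (1 - 2 * 0) ^ 2 / 3) :=
    mul_nonneg (mul_nonneg hs.le hpos.le) (by norm_num)
  have hB : 0 ≤ Real.sqrt 3 * h * (56 / 3 + 4 / 3 * (0 * (1 - 0))) :=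
    mul_nonneg (mul_nonneg hs.le hpos.le) (by norm_num)
  rw [ebot, emid, etop, ← ENNReal.ofReal_add hB hA, ← ENNReal.ofReal_add (add_nonneg hB hA) hB]
  congr 1
  rw [hh, ← sqrt_three_mul_sqrt_two_thirds]; ring

/-- **fcc/twin minimise the homogenised Wulff-body volume, strictly**: for `0 < f < 1`,
`|W_0| < |W_f|` (first-order penalty `4√2 f(1−f)` in the minority-letter density). -/
theorem volume_stackWulff_zero_lt (f : ℝ) (hf0 : 0 < f) (hf1 : f < 1) :
    volume (stackWulff 0) < volume (stackWulff f) := by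
  refine lt_of_lt_of_le ?_ (le_volume_stackWulff f hf0.le hf1.le)
  rw [volume_stackWulff_zero, ENNReal.ofReal_lt_ofReal_iff (by positivity)]
  have hs : 0 < Real.sqrt 2 := Real.sqrt_pos.2 (by norm_num)
  nlinarith [mul_pos hf0 (sub_pos.2 hf1), hs]

/-- For every `f ∈ [0,1]`: `|W_0| ≤ |W_f|`. -/
theorem volume_stackWulff_zero_le (f : ℝ) (hf0 : 0 ≤ f) (hf1 : f ≤ 1) :
    volume (stackWulff 0) ≤ volume (stackWulff f) := by
  refine le_trans ?_ (le_volume_stackWulff f hf0 hf1)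
  rw [volume_stackWulff_zero]
  apply ENNReal.ofReal_le_ofReal
  have hs : 0 < Real.sqrt 2 := Real.sqrt_pos.2 (by norm_num)
  nlinarith [mul_nonneg hf0 (sub_nonneg.2 hf1), hs]

end Summit.Ventures.Crystal3D.Theorems

end
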